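import Summits.PneNP.PneNP.Theorems.NPNotSubsetBPP
import Summits.PneNP.PneNP.Theorems.PhaseTwinsNoFBPPApproxAboveUniquenessConjectureWeb
import Summits.PneNP.PneNP.Theorems.PhaseTwinsNoFBPPApproxAboveUniquenessCalibrationWeb
import Literature.Computability.Complexity.ClayProblemProofs
import Literature.Computability.MetaComplexity.ConstructiveSeparationsNP

/-!
# Crux `NoFBPPApproxAboveUniqueness` (stmt-PneNP-2717) as a conditional bridge on the conjecture node `NPNotSubsetBPP`

Route PhaseTwins, crux X := `Summit.PneNP.PneNP.Theses.PhaseTwins.NoFBPPApproxAboveUniqueness` ("for some `Δ ≥ 3`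
and `λ = p/q > λ_c(Δ)` no FP transducer FBPP-approximates the hard-core partition function"). Two lines, the crux's
disprover, two triagers and the strategist census (`Cruxes/NoFBPPApproxAboveUniqueness/STRATEGY-CENSUS.md`) pin X
EXACTLY at the open conjecture `NP ⊄ BPP` (kernel-checked, fact-free: `noFBPPApproxAboveUniqueness_iff_not_NP_subset_BPP`,
`…Calibration.lean`). This file restates that calibration for the registered conjecture NODE
`Summit.PneNP.PneNP.NPNotSubsetBPP` (`Theorems/NPNotSubsetBPP.lean`, `@[conjecture] def … := ¬ (NP ⊆ BPP)`), which is
what a planner needs to carry the route as `--conditional-bridge --conditional-on NPNotSubsetBPP`: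

* `noFBPPApproxAboveUniqueness_iff_NPNotSubsetBPP` — **X ↔ NPNotSubsetBPP** (registered sub-goal of stmt-PneNP-2717);
* `noFBPPApproxAboveUniqueness_of_NPNotSubsetBPP` — **the bridge `NPNotSubsetBPP → X`** (one line over p93858);
* `pneNP_of_NPNotSubsetBPP` — **`NPNotSubsetBPP → PneNP`** through the route's own deciding chain
  (`PhaseTwins.closes` with `hardcoreCountSharpP_proof`, `phaseTwins_assembly_proof` — both proved), and
  `pneNP_of_NPNotSubsetBPP_direct`, the same arrow by `P ⊆ BPP` alone (registered sub-goal);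
* the node in the web of the tree's registered conjectures, all fact-free: `NPNotSubsetBPP ↔ NP ≠ RP` (Ko),
  `↔ PH ≠ BPP` (Zachos + Sipser–Gács–Lautemann), `↔ SAT ∉ BPP` (Cook–Levin + closure of `BPP` under `≤ₚ`);
  `NPNotSubsetPPoly → NPNotSubsetBPP` (Adleman), `OWFExist → NPNotSubsetBPP`, `PRGExist → NPNotSubsetBPP`;
* `conjecture_node_web` — the above as one conjunction (the planner's re-typing sheet).

Nothing here is new mathematics: every arrow is a landed theorem of `…Calibration{,Web}.lean` / `…ConjectureWeb.lean`
or a Literature theorem, re-addressed to the node's NAME. What is deliberately NOT here: any claim on `NPNotSubsetBPP`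
itself (open; it implies the summit).
-/

set_option linter.dupNamespace false -- `Summit.PneNP.PneNP.…` is the layout-mandated namespace (summit = sub-problem)

namespace Summit.PneNP.PneNP.Theorems.NoFBPPApproxAboveUniqueness

open Literature.Computability.Complexity
open Summit.PneNP.PneNP (NPNotSubsetBPP NPNotSubsetBPP_iff NPNotSubsetPPoly)
open Summit.PneNP.PneNP.Theses.PhaseTwins (NoFBPPApproxAboveUniqueness)

/-! ### The crux and the node -/

/-- **X ↔ `NPNotSubsetBPP`** — the calibration `noFBPPApproxAboveUniqueness_iff_not_NP_subset_BPP` (p93858, fact-free)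
addressed to the conjecture node. Registered sub-goal of stmt-PneNP-2717. [folklore] -/
theorem noFBPPApproxAboveUniqueness_iff_NPNotSubsetBPP : NoFBPPApproxAboveUniqueness ↔ Summit.PneNP.PneNP.NPNotSubsetBPP :=
  noFBPPApproxAboveUniqueness_iff_not_NP_subset_BPP.trans NPNotSubsetBPP_iff.symm

/-- **The conditional bridge: `NPNotSubsetBPP → X`.** This one line is the whole proof of route PhaseTwins' crux from the
node (for `--conditional-bridge --conditional-on NPNotSubsetBPP`). [folklore] -/
theorem noFBPPApproxAboveUniqueness_of_NPNotSubsetBPP (h : NPNotSubsetBPP) : NoFBPPApproxAboveUniqueness :=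
  noFBPPApproxAboveUniqueness_iff_NPNotSubsetBPP.2 h

/-- **X gives the node back** (the crux is not weaker than the conjecture). [folklore] -/
theorem npNotSubsetBPP_of_noFBPPApproxAboveUniqueness (h : NoFBPPApproxAboveUniqueness) : NPNotSubsetBPP :=
  noFBPPApproxAboveUniqueness_iff_NPNotSubsetBPP.1 h

/-! ### The node implies the summit -/

/-- **`NPNotSubsetBPP → PneNP` through the route**: bridge, then `X → PneNP` (`pneNP_of_noFBPPApproxAboveUniqueness`:
`PhaseTwins.closes` fed with the proved `hardcoreCountSharpP_proof` and `phaseTwins_assembly_proof`). Registered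
sub-goal of stmt-PneNP-2717. [folklore] -/
theorem pneNP_of_NPNotSubsetBPP : Summit.PneNP.PneNP.NPNotSubsetBPP → _root_.PneNP :=
  fun h => pneNP_of_noFBPPApproxAboveUniqueness (noFBPPApproxAboveUniqueness_of_NPNotSubsetBPP h)

/-- The summit in the prelude's classes: `PneNP ↔ NP ⊄ P` (model bridges `P_bool_eq_holds`, `NP_bool_eq_holds`, both
proved in the tree). [folklore] -/
theorem pneNP_iff_not_NP_subset_P : _root_.PneNP ↔ ¬ (Nondeterministic.NP ⊆ Classes.P) := by
  have hP : PNPWave0.P Bool = Classes.P := P_bool_eq_holds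
  have hNP : PNPWave0.NP Bool = Nondeterministic.NP := NP_bool_eq_holds
  show Literature.PNP.PNeNP ↔ _
  unfold Literature.PNP.PNeNP
  rw [hP, hNP, Set.not_subset]

/-- **`NPNotSubsetBPP → PneNP` directly** (`P ⊆ BPP`, `not_NP_subset_P_of_not_NP_subset_BPP`), without the hard-core
route: the node sits one derandomisation step above the summit. [folklore] -/
theorem pneNP_of_NPNotSubsetBPP_direct (h : NPNotSubsetBPP) : _root_.PneNP :=
  pneNP_iff_not_NP_subset_P.2 (Literature.Computability.MetaComplexity.not_NP_subset_P_of_not_NP_subset_BPP h)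

/-! ### The node in the web of registered conjectures (all fact-free) -/

/-- **`NPNotSubsetBPP ↔ NP ≠ RP`** (Ko 1982: `NP ⊆ BPP → NP = RP`, proved in the tree as `NP_eq_RP_of_NP_subset_BPP`;
conversely `RP ⊆ BPP`). [cite: Ko1982, main theorem] -/
theorem npNotSubsetBPP_iff_NP_ne_RP : NPNotSubsetBPP ↔ Nondeterministic.NP ≠ RP :=
  noFBPPApproxAboveUniqueness_iff_NPNotSubsetBPP.symm.trans noFBPPApproxAboveUniqueness_iff_NP_ne_RP

/-- **`NPNotSubsetBPP ↔ PH ≠ BPP`** (Zachos 1988 with Sipser–Gács–Lautemann: `NP ⊆ BPP → PH = BPP`; conversely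
`NP ⊆ PH`). [cite: FortnowGrochow2011, Cor. 4.4 (proof)] -/
theorem npNotSubsetBPP_iff_PH_ne_BPP : NPNotSubsetBPP ↔ PH ≠ BPP :=
  noFBPPApproxAboveUniqueness_iff_NPNotSubsetBPP.symm.trans noFBPPApproxAboveUniqueness_iff_PH_ne_BPP

/-- **`NPNotSubsetBPP ↔ SAT ∉ BPP`** (`SAT` is NP-complete, `BPP` is closed under Karp reductions — both proved in the
tree). [cite: AroraBarakCC2009, Lemma 2.11] -/
theorem npNotSubsetBPP_iff_SAT_not_mem_BPP : NPNotSubsetBPP ↔ SAT ∉ BPP :=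
  noFBPPApproxAboveUniqueness_iff_NPNotSubsetBPP.symm.trans noFBPPApproxAboveUniqueness_iff_SAT_not_mem_BPP

/-- **`NPNotSubsetPPoly → NPNotSubsetBPP`** (Adleman `BPP ⊆ P/poly`, `BPP_subset_PPoly_holds`): the circuit form of the
summit sits above the node. [cite: AroraBarakCC2009, Thm. 7.14] -/
theorem npNotSubsetBPP_of_NPNotSubsetPPoly (h : NPNotSubsetPPoly) : NPNotSubsetBPP :=
  npNotSubsetBPP_of_noFBPPApproxAboveUniqueness (noFBPPApproxAboveUniqueness_of_NPNotSubsetPPoly h)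

/-- **`OWFExist → NPNotSubsetBPP`** (one-way functions exclude `NP ⊆ BPP`; `NP_not_subset_BPP_of_OWFExist_holds`).
[cite: Goldreich2001, §2.7.3 and §1.5.3] -/
theorem npNotSubsetBPP_of_OWFExist (h : Literature.Computability.Cryptography.OWFExist) : NPNotSubsetBPP :=
  npNotSubsetBPP_of_noFBPPApproxAboveUniqueness (noFBPPApproxAboveUniqueness_of_OWFExist h)

/-- **`PRGExist → NPNotSubsetBPP`** (`PRGExist → OWFExist`; `NP_not_subset_BPP_of_PRGExist`). [cite: Goldreich2001, §3.3.6] -/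
theorem npNotSubsetBPP_of_PRGExist (h : Literature.Computability.Cryptography.PRGExist) : NPNotSubsetBPP :=
  npNotSubsetBPP_of_noFBPPApproxAboveUniqueness (noFBPPApproxAboveUniqueness_of_PRGExist h)

/-- **The re-typing sheet.** Above the node: `OWFExist`, `PRGExist`, `NPNotSubsetPPoly`; at the node: X, `NP ≠ RP`,
`PH ≠ BPP`, `SAT ∉ BPP`; below it: the summit. Every arrow kernel-checked with no named fact. [folklore] -/
theorem conjecture_node_web :
    (Literature.Computability.Cryptography.OWFExist ∨ Literature.Computability.Cryptography.PRGExist ∨ NPNotSubsetPPoly →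
      NPNotSubsetBPP) ∧
    (NoFBPPApproxAboveUniqueness ↔ NPNotSubsetBPP) ∧
    (NPNotSubsetBPP ↔ Nondeterministic.NP ≠ RP) ∧
    (NPNotSubsetBPP ↔ PH ≠ BPP) ∧
    (NPNotSubsetBPP ↔ SAT ∉ BPP) ∧
    (NPNotSubsetBPP → _root_.PneNP) :=
  ⟨fun h => h.elim npNotSubsetBPP_of_OWFExist fun h' => h'.elim npNotSubsetBPP_of_PRGExist npNotSubsetBPP_of_NPNotSubsetPPoly,
    noFBPPApproxAboveUniqueness_iff_NPNotSubsetBPP, npNotSubsetBPP_iff_NP_ne_RP, npNotSubsetBPP_iff_PH_ne_BPP,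
    npNotSubsetBPP_iff_SAT_not_mem_BPP, pneNP_of_NPNotSubsetBPP⟩

end Summit.PneNP.PneNP.Theorems.NoFBPPApproxAboveUniqueness
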